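import Summits.AtomisticToContinuum.HydrodynamicLimit.Theorems.OneFlightGossipEngineCollisionActivityTailsPreShockEnvelope
import Summits.AtomisticToContinuum.HydrodynamicLimit.Theorems.OneFlightGossipEngineOneFlightLayeredChaosRegimes
import Summits.AtomisticToContinuum.HydrodynamicLimit.Theorems.JParityClosureCollisionTightnessDomination
import Literature.MathematicalPhysics.KineticTheory.Sweep1CanonicalDataProofs
import Literature.MathematicalPhysics.KineticTheory.HardSphereBBGKYProofs
import Literature.MathematicalPhysics.KineticTheory.HardSphereEulerProofs
import HarnessLib

/-!
# EC: the Gaussian envelope of the evolved GLOBAL-equilibrium law, all times, general drift `ū`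
# (`stub_envelopeBound_const`, crux stmt-AtomisticToContinuum-13481 `InformationPercolationEngine.CollisionRate`, line `Sketch`)

The crux `CollisionRate` is kernel-reduced to a marginal-envelope hypothesis (A) on the evolved local Gibbs law; (A)
follows from the crux item `BGEndpointRigidity.LanfordEnvelopeR`.  This file proves the SANITY TWIN of that item at
CONSTANT profiles `(ā, ū, θ̄)` (global equilibrium with a drift), where it holds for ALL times `r` with `β, C`
independent of `r`, `N` and of the flow:

* `indicator_hsTransport_const_ae_eq` (landed, `…CollisionActivityTailsPreShockEnvelope`): the canonical density of a
  constant profile is flow-invariant on the good set, so `𝟙_D · (W_N ∘ Φ_{-r}) = W_N` a.e. and the marginals agree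
  a.e. (`nthMarginal_congr_ae`); time and flow disappear.
* the activity `ā` cancels from the canonical density (`OLC.canonicalDensity_const_mul'`), leaving the datum
  `f₀(x, v) = M_{1, ū, θ̄}(v)`, the SHIFTED Maxwellian, of mass one on `𝕋³ × ℝ³`
  (`integral_localMaxwellian_phaseSpace`);
* Gaussian domination of the shifted Maxwellian by a centred one at half the inverse temperature,
  `M_{1,ū,θ̄}(v) ≤ (2πθ̄)^{-3/2} e^{|ū|²/(2θ̄)} e^{-|v|²/(4θ̄)}` (`localMaxwellian_le_gauss`, from
  `|v|² ≤ 2|v-ū|² + 2|ū|²`, the landed `Theorems.norm_sq_le_two_mul_add`), i.e. `f₀ ≤ C' M_β`, `β = (2θ̄)⁻¹`;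
* GST 2013 Prop. 6.1.2 (first step) `LanfordEmpirical.nthMarginal_canonicalDensity_le_two_pow_mul`:
  `f_{0,N+1}^{(s)} ≤ 2^s 𝟙_{D^s} f₀^{⊗s}` in the dilution regime `N (2ε_N)³ C' ≤ 1/2`, which at fixed reduced
  density (`(N+1) ε_N³ = σ³`) reads `8σ³ C' ≤ 1/2` and holds once `σ < σ₀ := (16 C' + 1)⁻¹` (`regime_of_lt_inv`) —
  this is where `σ₀` depends on `(ū, θ̄)`;
* the factor-by-factor Gaussian bound `f₀^{⊗s} ≤ K^s e^{-β E(Z_s)}` (`tensorPow_le_pow_mul_exp_neg_mul_configEnergy`).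

Hence the envelope with `C = 2K`, `K = (2πθ̄)^{-3/2} e^{|ū|²/(2θ̄)}`; orders `s > N + 1` have zero marginal.  At `ū = 0`
this is `CollisionActivityTailsPreShockEnvelope.envelope_const` (BGSR 2016 Prop. 3.2/4.1), whose proof is adapted here.

References: T. Bodineau, I. Gallagher, L. Saint-Raymond, Invent. Math. 203 (2016), Prop. 3.2, Prop. 4.1, Appendix A;
I. Gallagher, L. Saint-Raymond, B. Texier, *From Newton to Boltzmann* (2013), Prop. 6.1.2; H. Spohn, *Large Scale
Dynamics of Interacting Particles* (1991), Part I §2.3.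
-/

open scoped BigOperators Topology Classical MeasureTheory ProbabilityTheory InnerProductSpace ENNReal
open Filter Set Function MeasureTheory
open Literature.Analysis.FluidPDE Literature.MathematicalPhysics.KineticTheory

noncomputable section

namespace Summit.AtomisticToContinuum.HydrodynamicLimit.Theorems.CollisionRate

open Literature.Analysis.FunctionSpaces (maxwellianBeta)
open Summit.AtomisticToContinuum.HydrodynamicLimit.Theorems.OLC (canonicalDensity_const_mul')
open Summit.AtomisticToContinuum.HydrodynamicLimit.Theorems.CollisionActivityTailsPreShockEnvelope
  (indicator_hsTransport_const_ae_eq)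

/-! ### §1 The shifted Maxwellian: mass one, Gaussian domination -/

/-- **Gaussian domination of the shifted Maxwellian** by a centred Gaussian at half the inverse temperature:
`M_{1,u,θ}(v) ≤ (2πθ)^{-3/2} e^{|u|²/(2θ)} · e^{-((2θ)⁻¹/2)|v|²}` (`θ > 0`; from `|v|² ≤ 2|v-u|² + 2|u|²`,
`Theorems.norm_sq_le_two_mul_add`). [folklore] -/
theorem localMaxwellian_le_gauss {θ : ℝ} (hθ : 0 < θ) (u v : V3) :
    localMaxwellian 1 θ u v ≤
      (2 * Real.pi * θ) ^ (-(3 : ℝ) / 2) * Real.exp (‖u‖ ^ 2 / (2 * θ)) * Real.exp (-((2 * θ)⁻¹ / 2) * ‖v‖ ^ 2) := by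
  have hK0 : 0 ≤ (2 * Real.pi * θ) ^ (-(3 : ℝ) / 2) := Real.rpow_nonneg (by positivity) _
  have h2 := norm_sq_le_two_mul_add v u
  have hτ : 0 < (2 * θ)⁻¹ := by positivity
  have hexp : -‖v - u‖ ^ 2 / (2 * θ) ≤ ‖u‖ ^ 2 / (2 * θ) + -((2 * θ)⁻¹ / 2) * ‖v‖ ^ 2 := by
    rw [div_eq_mul_inv (-‖v - u‖ ^ 2), div_eq_mul_inv (‖u‖ ^ 2)]
    nlinarith [mul_le_mul_of_nonneg_left h2 hτ.le]
  calc localMaxwellian 1 θ u v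
      = (2 * Real.pi * θ) ^ (-(3 : ℝ) / 2) * Real.exp (-‖v - u‖ ^ 2 / (2 * θ)) := by
        simp only [localMaxwellian, finrank_euclideanSpace_fin, Nat.cast_ofNat, one_mul]
    _ ≤ (2 * Real.pi * θ) ^ (-(3 : ℝ) / 2) * Real.exp (‖u‖ ^ 2 / (2 * θ) + -((2 * θ)⁻¹ / 2) * ‖v‖ ^ 2) :=
        mul_le_mul_of_nonneg_left (Real.exp_le_exp.2 hexp) hK0
    _ = _ := by rw [Real.exp_add]; ring

/-- The shifted Maxwellian has mass one on phase space `𝕋³ × ℝ³` (unit volume of the torus). [folklore] -/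
theorem integral_localMaxwellian_phaseSpace {θ : ℝ} (hθ : 0 < θ) (u : V3) :
    ∫ z : T3 × V3, localMaxwellian 1 θ u z.2 = 1 := by
  rw [Measure.volume_eq_prod, integral_fun_snd]
  simp [integral_localMaxwellian_one hθ u]

/-! ### §2 The dilution regime at fixed reduced density -/

/-- The dilution regime of GST Prop. 6.1.2 / BGSR Prop. 3.2 at fixed reduced density with a domination constant `C`:
`N (2 ε_N)³ C ≤ 8σ³ C ≤ 1/2` once `0 < σ < (16 C + 1)⁻¹` (`(N+1) ε_N³ = σ³`, `σ ≤ 1`). [folklore] -/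
theorem regime_of_lt_inv {C σ : ℝ} (hC : 0 ≤ C) (hσ : 0 < σ) (hσlt : σ < (16 * C + 1)⁻¹) (N : ℕ) :
    ((N + 1 - 1 : ℕ) : ℝ) * (2 * hsDiameter σ N) ^ Fintype.card (Fin 3) * C ≤ 2⁻¹ := by
  have hε : 0 ≤ hsDiameter σ N := (hsDiameter_pos hσ N).le
  have hcube := succ_mul_hsDiameter_pow_three σ N
  simp only [Nat.add_sub_cancel, Fintype.card_fin]
  have hN : (N : ℝ) ≤ ((N + 1 : ℕ) : ℝ) := by exact_mod_cast N.le_succ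
  have hε3 : 0 ≤ hsDiameter σ N ^ 3 := pow_nonneg hε 3
  have h16 : 0 < 16 * C + 1 := by positivity
  have hσ1 : σ * (16 * C + 1) < 1 := by
    have h := mul_lt_mul_of_pos_right hσlt h16
    rwa [inv_mul_cancel₀ h16.ne'] at h
  have hσle : σ ≤ 1 := by nlinarith
  have hσ3 : σ ^ 3 ≤ σ := pow_le_of_le_one hσ.le hσle three_ne_zero
  calc (N : ℝ) * (2 * hsDiameter σ N) ^ 3 * C = 8 * ((N : ℝ) * hsDiameter σ N ^ 3) * C := by ring
    _ ≤ 8 * (((N + 1 : ℕ) : ℝ) * hsDiameter σ N ^ 3) * C := by gcongr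
    _ = 8 * σ ^ 3 * C := by rw [hcube]
    _ ≤ 8 * σ * C := by gcongr
    _ ≤ 2⁻¹ := by nlinarith

/-! ### §3 The registered stub -/

/-- **EC · THE ENVELOPE AT CONSTANT PROFILES, ALL TIMES.** For `ā, θ̄ > 0`, every drift `ū` and
`0 < σ < σ₀(ū, θ̄) = (16 C' + 1)⁻¹`, `C' = (2πθ̄)^{-3/2} e^{|ū|²/(2θ̄)} (2π/β)^{3/2}`, `β = (2θ̄)⁻¹`: with
`C = 2 (2πθ̄)^{-3/2} e^{|ū|²/(2θ̄)}`, for every `N`, every hard-sphere flow, every order `s` and every time `r`, for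
a.e. `Z_s` the `s`-marginal of `𝟙_D · (W_N ∘ Φ_{-r})`, `W_N` the canonical density of the constant local Gibbs profile
`(ā, ū, θ̄)`, is at most `C^s e^{-β E(Z_s)}` (stationarity of the global Gibbs density + GST 2013 Prop. 6.1.2 first
step for the shifted Maxwellian dominated by `C' M_β`; the case `ū = 0` is BGSR 2016 Prop. 3.2/4.1,
`CollisionActivityTailsPreShockEnvelope.envelope_const`). [cite: BodineauGallagherSaintRaymondInvent2016, Prop. 3.2, Prop. 4.1] -/
theorem stub_envelopeBound_const :
    ∀ (ab θb : ℝ) (ub : V3), 0 < ab → 0 < θb → ∃ σ₀ : ℝ, 0 < σ₀ ∧ ∀ σ : ℝ, 0 < σ → σ < σ₀ → ∃ β C : ℝ, 0 < β ∧ 0 ≤ C ∧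
      ∀ (N : ℕ) (Φ : HardSphereFlow (Torus.geometry (Fin 3)) (hsDiameter σ N) (N + 1)) (s : ℕ) (r : ℝ),
      ∀ᵐ Zs : Config s (Fin 3) T3,
        |nthMarginal (N + 1) s ((hardSphereDomain (Torus.geometry (Fin 3)) (N + 1) (hsDiameter σ N)).indicator
            (hsTransport Φ r (canonicalDensity (Torus.geometry (Fin 3)) (hsDiameter σ N) (N + 1)
              (localGibbsProfile (fun _ => ab) (fun _ => ub) (fun _ => θb))))) Zs| ≤ C ^ s * Real.exp (-(β * configEnergy Zs)) := by
  intro ab θb ub hab hθb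
  -- the dominating centred Gaussian: inverse temperature `β = (2θ̄)⁻¹`, constant `K`, normalisation `cβ` of `M_β`
  have hβ : 0 < (2 * θb)⁻¹ := by positivity
  obtain ⟨K, hK, hKle⟩ : ∃ K : ℝ, 0 < K ∧
      ∀ v : V3, localMaxwellian 1 θb ub v ≤ K * Real.exp (-((2 * θb)⁻¹ / 2) * ‖v‖ ^ 2) :=
    ⟨_, mul_pos (Real.rpow_pos_of_pos (by positivity) _) (Real.exp_pos _), localMaxwellian_le_gauss hθb ub⟩
  obtain ⟨cβ, hcβ, hcβeq⟩ : ∃ c : ℝ, 0 < c ∧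
      ∀ v : V3, maxwellianBeta (2 * θb)⁻¹ v = c * Real.exp (-((2 * θb)⁻¹ / 2) * ‖v‖ ^ 2) :=
    ⟨_, Real.rpow_pos_of_pos (by positivity) _, maxwellianBeta_eq (2 * θb)⁻¹⟩
  have hC' : 0 < K * cβ⁻¹ := mul_pos hK (inv_pos.2 hcβ)
  refine ⟨(16 * (K * cβ⁻¹) + 1)⁻¹, by positivity, fun σ hσ hσlt => ⟨(2 * θb)⁻¹, 2 * K, hβ, by positivity, ?_⟩⟩
  intro N Φ s r
  -- the one-particle datum once the activity is divided out: the shifted Maxwellian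
  set f₀ : T3 × V3 → ℝ := fun p => localMaxwellian 1 θb ub p.2 with hf₀def
  have hf₀m : Measurable f₀ := (continuous_localMaxwellian 1 θb ub).measurable.comp measurable_snd
  have hf₀0 : 0 ≤ f₀ := fun p => localMaxwellian_nonneg zero_le_one hθb.le ub p.2
  have hf₀K : ∀ (x : T3) (v : V3), f₀ (x, v) ≤ K * Real.exp (-((2 * θb)⁻¹ / 2) * ‖v‖ ^ 2) :=
    fun _ v => hKle v
  have hf₀b : ∀ z : T3 × V3, f₀ z ≤ K * cβ⁻¹ * maxwellianBeta (2 * θb)⁻¹ z.2 := fun z => by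
    rw [hcβeq, mul_assoc, inv_mul_cancel_left₀ hcβ.ne']
    exact hf₀K z.1 z.2
  have hf₀1 : ∫ z, f₀ z = 1 := integral_localMaxwellian_phaseSpace hθb ub
  have hprof : localGibbsProfile (fun _ => ab) (fun _ => ub) (fun _ => θb) = fun p => ab * f₀ p := rfl
  -- stationarity: time and flow disappear a.e.
  have hae := Literature.MathematicalPhysics.KineticTheory.nthMarginal_congr_ae (s := s)
    (indicator_hsTransport_const_ae_eq ab θb ub Φ r)
  filter_upwards [hae] with Zs hZs
  rw [hZs, hprof, canonicalDensity_const_mul' _ _ _ _ hab.ne']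
  rcases le_or_gt s (N + 1) with hs | hs
  · have hnn : 0 ≤ nthMarginal (N + 1) s
        (canonicalDensity (Torus.geometry (Fin 3)) (hsDiameter σ N) (N + 1) f₀) Zs :=
      nthMarginal_nonneg (N + 1) s (LanfordEmpirical.canonicalDensity_nonneg' hf₀0) Zs
    rw [abs_of_nonneg hnn]
    refine (LanfordEmpirical.nthMarginal_canonicalDensity_le_two_pow_mul hβ hC'.le (hsDiameter_pos hσ N).le
      hf₀m hf₀0 hf₀b hf₀1 hs (regime_of_lt_inv hC'.le hσ hσlt N) Zs).trans ?_
    have hT0 : 0 ≤ tensorPow s f₀ Zs := tensorPow_nonneg hf₀0 s Zs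
    calc 2 ^ s * (hardSphereDomain (Torus.geometry (Fin 3)) s (hsDiameter σ N)).indicator (tensorPow s f₀) Zs
        ≤ 2 ^ s * tensorPow s f₀ Zs :=
          mul_le_mul_of_nonneg_left (indicator_le_self' (fun _ _ => hT0) Zs) (by positivity)
      _ ≤ 2 ^ s * (K ^ s * Real.exp (-(2 * θb)⁻¹ * configEnergy Zs)) :=
          mul_le_mul_of_nonneg_left (tensorPow_le_pow_mul_exp_neg_mul_configEnergy hf₀0 hf₀K s Zs)
            (by positivity)
      _ = (2 * K) ^ s * Real.exp (-((2 * θb)⁻¹ * configEnergy Zs)) := by rw [mul_pow, neg_mul]; ring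
  · have h0 : nthMarginal (N + 1) s
        (canonicalDensity (Torus.geometry (Fin 3)) (hsDiameter σ N) (N + 1) f₀) Zs = 0 := by
      simp [nthMarginal, not_le.2 hs]
    rw [h0, abs_zero]
    positivity

end Summit.AtomisticToContinuum.HydrodynamicLimit.Theorems.CollisionRate

end
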